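import Summits.ResolutionOfSingularities.ResolutionOfSingularities.Theorems.UniformComplexityCampaignW82SeparableTightnessTwoFibres
import Summits.ResolutionOfSingularities.ResolutionOfSingularities.Theorems.UniformComplexityCampaignW82SeparableTightnessCompactification
import Summits.ResolutionOfSingularities.ResolutionOfSingularities.Theorems.UniformComplexityCampaignW82FamilyResolutionSep
import Summits.ResolutionOfSingularities.ResolutionOfSingularities.Theorems.UniformComplexityCampaignW82TwistExponentUnbounded
import Mathlib.RingTheory.Unramified.Field
import Mathlib.RingTheory.Unramified.Finite
import Mathlib.RingTheory.Localization.BaseChange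
import Mathlib.FieldTheory.Separable
import Mathlib.RingTheory.Polynomial.IrreducibleRing
import Mathlib.Algebra.CharP.Algebra
import HarnessLib

/-!
# [OURS · L1 W8.2] SEPARABLE TIGHTNESS OF RESOLUTION IN FAMILIES: `¬ FamilyResolutionSep k` for every field
# `k` of characteristic `p > 0`

Cell `res-hironaka` (run/shared/lean/pub/res-hironaka/), LADDER-RESOLUTION rung L (RESCUE), slot W8.2 of
plan/RESCUE-SEED.md («PRIME-FIELD / UNIVERSALITY TRANSFER instead of descent: resolve over 𝔽_p or 𝔽̄_p and
transfer FAMILIES»), door 2: route `UniformComplexity`, host item `PrimeModelTransfer`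
(stmt-ResolutionOfSingularities-8933); prover res-L1-s82-pv-2 (gen 7). THESES-FREE module (imports the gen-7
siblings `…SeparableTightnessTwoFibres`, `…SeparableTightnessCompactification`, the OURS statement file
`…FamilyResolutionSep` (p554368), the gen-3 sibling `…TwistExponentUnbounded` (the auxiliary prime
`TwistExponent.altPrime p ≠ p`), Mathlib, `HarnessLib`).

THE RESULT. The family form of the crux (`CampaignW82.FamilyResolution`, p526769; door 2 crux slice ⟺
`FamilyResolution 𝔽̄_p`, `CampaignW82.algClosedRes_iff_familyResolution` p532272) allows an ALGEBRAIC base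
extension `A → A'` before asking for one simultaneous weak resolution of all field-valued fibres; its docstring
says «the algebraic base extension is where the inseparability is absorbed». `CampaignW82.FamilyResolutionSep k`
(p554368) is the same statement with `A → A'` required SEPARABLE (generic fibre formally unramified = generically
étale). This file proves

* **`not_familyResolutionSep : ∀ k` field, `CharP k p`, `p` prime `→ ¬ FamilyResolutionSep k`** — for EVERY
  field of positive characteristic (finite, `𝔽̄_p`, perfect or not), and in particular
  `not_familyResolutionSep_algebraicClosure_zmod p : ¬ FamilyResolutionSep (AlgebraicClosure (ZMod p))`.
* `not_familyResolutionSep_of_pencilWitness` — the witness theorem: ANY finitely generated `k`-domain `A` with an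
  element `t` such that `X^p − t` is irreducible over `Frac A` witnesses it, through the compactified Kollár
  pencil `𝒳̄ ⊇ {y^q = x^p − t} → Spec A` (`exists_compactifiedPencil`, integral geometric generic fibre by
  `isIntegral_pullback_of_pencil_dense`) and the two-fibre obstruction at the generic and geometric generic
  points of `Spec A'` (`false_of_isWeakResolution_two_fibres`, p557947).
* `irreducible_X_pow_sub_C_of_formallyUnramified` — the algebra of separability: if `A → A'` is injective of
  finite type between domains and `Frac A ⊗_A A'` is formally unramified over `Frac A`, then `X^p − t` stays
  irreducible over `Frac A'` (`Frac A ⊗_A A'` is a field finite separable over `Frac A` by Mathlib's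
  `Algebra.FormallyUnramified.finite_of_free` / `.isSeparable`; a `p`-th root of `t` would be a separable
  element with the inseparable minimal polynomial `X^p − t`); `irreducible_X_pow_sub_C_polynomialX` — `t` is not
  a `p`-th power in `k(t)`.

READING (numbers, not adjectives). Together with the door-1 theorem `CampaignW82.perfectRes_iff_familyResolutionInsep`
(p535806: the RADICIAL variant `FamilyResolutionInsep p k` ⟺ resolution over perfect fields) the family form is now
pinned on both sides: the base extension in resolution in families MUST be inseparable (this file, unconditional,
every `k` of characteristic `p`) and MAY be taken purely inseparable (p535806, conditional on / equivalent to
`PerfectRes p`). Mechanism census of the residual (gens 3–6: twist exponent unbounded p510058/p513490; normalising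
never suffices from dimension 2, p518256; selection necessary, p512610; one smooth closed fibre + flatness
suffices, p545198) gains: «separable base change never suffices, already for curves (fibre dimension 1) and
already at the generic point». No claim about the crux itself (open problem; first open family grade 4).

HONEST FRAMING. OURS negative-side theorem about OURS campaign statements; NOT a statement of H. Hironaka's 2017
manuscript *Resolution of singularities in positive characteristics* ([Hironaka2017], lit key
`paper:url-3343fd9e678b`); the printed item whose ROLE the refuted statement replaces is §17 ¶2, p.89 l.59–62
(the «transcendence degree d ↦ dimension d + dim Z» reformulation), quoted for the role, not asserted; nothing here
is attributed to the author and no verdict on the manuscript is implied. AI work, weaker than expert review.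

## References (vocabulary and locators only)
* J. Kollár, *Lectures on Resolution of Singularities* (2007), 1.19 (the regular non-smooth curve
  `y^q = x^p − t`). [Kollar2007]
* The Stacks Project, Tags 00UU / 02GL (unramified over a field ⟺ finite separable), 02VL (fpqc descent of
  smoothness), 0F41, 01R8, 0CMK. [StacksProject]
* H. Hironaka, ms. 2017-03-23, §17 ¶2 p.89 l.59–62 — under adjudication, role only. [Hironaka2017]
-/

noncomputable section

set_option linter.dupNamespace false -- mandated namespace of this single-conjunct summit

open Polynomial
open _root_.CategoryTheory _root_.CategoryTheory.Limits _root_.AlgebraicGeometry _root_.TopologicalSpace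
open Literature.AlgebraicGeometry.Resolution

namespace Summit.ResolutionOfSingularities.ResolutionOfSingularities.Theorems.CampaignW82.SeparableTightness

/-! ## §1 Separable base extensions do not extract `p`-th roots -/

section Separable

open scoped TensorProduct

/-- In characteristic `p`, `X^p − c` is not separable (its derivative vanishes), so it is never the minimal
polynomial of a separable element; in particular an IRREDUCIBLE `X^p − c` has no root in any algebra all of
whose elements are separable over the base field. [folklore] -/
theorem not_separable_X_pow_sub_C {F : Type} [Field F] (p : ℕ) [Fact p.Prime] [CharP F p] (c : F)
    (hirr : Irreducible (X ^ p - C c : F[X])) : ¬ (X ^ p - C c : F[X]).Separable := by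
  intro hsep
  have hder : Polynomial.derivative (X ^ p - C c : F[X]) = 0 := by
    rw [Polynomial.derivative_sub, Polynomial.derivative_X_pow, Polynomial.derivative_C, sub_zero,
      CharP.cast_eq_zero F p, C_0, zero_mul]
  have h : IsCoprime (X ^ p - C c : F[X]) 0 := by simpa [Polynomial.Separable, hder] using hsep
  exact hirr.not_isUnit (isCoprime_zero_right.mp h)

/-- **A separable (generically étale) base extension does not extract a `p`-th root of `t`.** Let `A → A'`
be an injective, finite-type extension of domains of characteristic `p` whose generic fibre
`Frac A ⊗_A A'` is formally unramified over `Frac A` (the separability conjunct of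
`CampaignW82.FamilyResolutionSep`), and let `t ∈ A` with `X^p − t` irreducible over `Frac A`. Then `X^p − t`
stays irreducible over `Frac A'`. Proof: `B = Frac A ⊗_A A' = A'[(A ∖ 0)⁻¹]` is a domain, free of finite type
and formally unramified over the field `Frac A`, hence finite (Mathlib
`Algebra.FormallyUnramified.finite_of_free`), hence a field, separable over `Frac A`
(`Algebra.FormallyUnramified.isSeparable`); a `p`-th root `x/y ∈ Frac A'` of `t` gives the `p`-th root
`(1 ⊗ x)(1 ⊗ y)⁻¹ ∈ B`, a separable element with minimal polynomial the inseparable `X^p − t`.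
[cite: StacksProject, Tag 00UU] -/
theorem irreducible_X_pow_sub_C_of_formallyUnramified {A A' : Type} [CommRing A] [IsDomain A]
    [CommRing A'] [IsDomain A'] [Algebra A A'] (p : ℕ) [Fact p.Prime] [CharP A p]
    (hinj : Function.Injective (algebraMap A A')) (hft : Algebra.FiniteType A A')
    (hsep : Algebra.FormallyUnramified (FractionRing A) (FractionRing A ⊗[A] A'))
    (t : A) (ht : Irreducible (X ^ p - C (algebraMap A (FractionRing A) t) : (FractionRing A)[X])) :
    Irreducible (X ^ p - C (algebraMap A' (FractionRing A') (algebraMap A A' t)) : (FractionRing A')[X]) := by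
  classical
  have hp : p.Prime := Fact.out
  -- `A'`-algebra structure `a' ↦ 1 ⊗ a'` on `Frac A ⊗[A] A'` (Mathlib's `rightAlgebra`, introduced locally; no local
  -- abbreviations: instance search must see `FractionRing A ⊗[A] A'` literally)
  letI : Algebra A' (FractionRing A ⊗[A] A') := Algebra.TensorProduct.rightAlgebra
  haveI : CharP (FractionRing A) p := charP_of_injective_algebraMap (IsFractionRing.injective A (FractionRing A)) p
  -- `B = Frac A ⊗ A'` is the localization of `A'` at the image of `A ∖ 0`, a domain into which `A'` injects
  have hM : Algebra.algebraMapSubmonoid A' (nonZeroDivisors A) ≤ nonZeroDivisors A' := by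
    rintro _ ⟨a, ha, rfl⟩
    exact mem_nonZeroDivisors_of_ne_zero fun h =>
      nonZeroDivisors.ne_zero ha (hinj (by rw [h, map_zero]))
  haveI : IsLocalization (Algebra.algebraMapSubmonoid A' (nonZeroDivisors A)) (FractionRing A ⊗[A] A') :=
    IsLocalization.tensorRight (R := A) (S := A') (FractionRing A) (nonZeroDivisors A)
  haveI : IsDomain (FractionRing A ⊗[A] A') :=
    IsLocalization.isDomain_of_le_nonZeroDivisors (FractionRing A ⊗[A] A') hM
  have hBinj : Function.Injective (algebraMap A' (FractionRing A ⊗[A] A')) :=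
    IsLocalization.injective (FractionRing A ⊗[A] A') hM
  -- `B` is finite over the field `Frac A` (formally unramified + free + finite type), hence a field
  haveI : Algebra.FiniteType A A' := hft
  haveI : Algebra.FiniteType (FractionRing A) (FractionRing A ⊗[A] A') := inferInstance
  haveI : Algebra.EssFiniteType (FractionRing A) (FractionRing A ⊗[A] A') :=
    Algebra.EssFiniteType.of_finiteType (FractionRing A) (FractionRing A ⊗[A] A')
  haveI : Algebra.FormallyUnramified (FractionRing A) (FractionRing A ⊗[A] A') := hsep
  haveI : Module.Finite (FractionRing A) (FractionRing A ⊗[A] A') :=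
    Algebra.FormallyUnramified.finite_of_free (FractionRing A) (FractionRing A ⊗[A] A')
  have hBf : IsField (FractionRing A ⊗[A] A') :=
    isField_of_isIntegral_of_isField' (Field.toIsField (FractionRing A))
  letI : Field (FractionRing A ⊗[A] A') := hBf.toField
  haveI : Algebra.IsSeparable (FractionRing A) (FractionRing A ⊗[A] A') :=
    Algebra.FormallyUnramified.isSeparable (FractionRing A) (FractionRing A ⊗[A] A')
  -- a `p`-th root of `t` in `Frac A'` would give one in `B`
  refine X_pow_sub_C_irreducible_of_prime hp fun b hb => ?_
  obtain ⟨x, y, hy, rfl⟩ := IsFractionRing.div_surjective (A := A') b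
  have hy0 : algebraMap A' (FractionRing A') y ≠ 0 :=
    IsFractionRing.to_map_ne_zero_of_mem_nonZeroDivisors hy
  have hxy : x ^ p = algebraMap A A' t * y ^ p := by
    apply IsFractionRing.injective A' (FractionRing A')
    rw [map_pow, map_mul, map_pow, ← hb, div_pow, div_mul_cancel₀ _ (pow_ne_zero _ hy0)]
  have hyB : algebraMap A' (FractionRing A ⊗[A] A') y ≠ 0 := fun h =>
    nonZeroDivisors.ne_zero hy (hBinj (by rw [h, map_zero]))
  set s : FractionRing A ⊗[A] A' :=
    algebraMap A' (FractionRing A ⊗[A] A') x / algebraMap A' (FractionRing A ⊗[A] A') y with hs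
  have h1 : algebraMap A' (FractionRing A ⊗[A] A') (algebraMap A A' t) =
      algebraMap (FractionRing A) (FractionRing A ⊗[A] A') (algebraMap A (FractionRing A) t) := by
    rw [← IsScalarTower.algebraMap_apply, ← IsScalarTower.algebraMap_apply]
  have hyBp : algebraMap A' (FractionRing A ⊗[A] A') (y ^ p) ≠ 0 := by
    rw [map_pow]; exact pow_ne_zero _ hyB
  have hsp : s ^ p = algebraMap (FractionRing A) (FractionRing A ⊗[A] A') (algebraMap A (FractionRing A) t) := by
    rw [hs, div_pow, ← map_pow, ← map_pow, hxy, map_mul, mul_div_assoc, div_self hyBp, mul_one, h1]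
  -- `s` is separable over `Frac A` with minimal polynomial `X^p − t`: contradiction
  have hmin : minpoly (FractionRing A) s = X ^ p - C (algebraMap A (FractionRing A) t) := by
    refine (minpoly.eq_of_irreducible_of_monic ht ?_ (monic_X_pow_sub_C _ hp.ne_zero)).symm
    rw [map_sub, map_pow, aeval_X, aeval_C, hsp, sub_self]
  have hs_sep : (minpoly (FractionRing A) s).Separable := Algebra.IsSeparable.isSeparable (FractionRing A) s
  rw [hmin] at hs_sep
  exact not_separable_X_pow_sub_C p (algebraMap A (FractionRing A) t) ht hs_sep

end Separable

/-! ## §2 The witness theorem and the headline -/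

section Headline

/-- **Any finitely generated domain `A` over `k` with an element `t` that is not a `p`-th power in `Frac A`
witnesses `¬ FamilyResolutionSep k`.** The proper family is the compactified Kollár pencil
`𝒳̄ → Spec A` (`exists_compactifiedPencil`), whose geometric generic fibre is integral
(`isIntegral_pullback_of_pencil_dense` along the flat `A → (Frac A)^{alg}`); for a base extension `A → A'`
as in `FamilyResolutionSep` (injective, finite type, algebraic, generic fibre formally unramified) the generic
point `A' → Frac A'` and the geometric generic point `A' → (Frac A')^{alg}` are two field-valued points over
which no `G` restricts to weak resolutions simultaneously (`false_of_isWeakResolution_two_fibres`):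
`A → Frac A'` is flat (`ringHom_flat_of_injective_of_field`) and `X^p − t` stays irreducible over `Frac A'`
(`irreducible_X_pow_sub_C_of_formallyUnramified`). The auxiliary prime is `q = altPrime p ≠ p`.
[cite: Kollar2007, 1.19] -/
theorem not_familyResolutionSep_of_pencilWitness {k : Type} [Field k] (p : ℕ) [Fact p.Prime] [CharP k p]
    (A : Type) [CommRing A] [IsDomain A] [Algebra k A] [Algebra.FiniteType k A] (t : A)
    (ht : Irreducible (X ^ p - C (algebraMap A (FractionRing A) t) : (FractionRing A)[X])) :
    ¬ FamilyResolutionSep k := by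
  have hp : p.Prime := Fact.out
  haveI : CharP A p := charP_of_injective_algebraMap (algebraMap k A).injective p
  -- the auxiliary prime `q ≠ p`
  let q := TwistExponent.altPrime p
  haveI : Fact q.Prime := ⟨TwistExponent.altPrime_prime p⟩
  have hqp : q ≠ p := TwistExponent.altPrime_ne hp
  -- the compactified pencil and its integral geometric generic fibre
  obtain ⟨𝒳, f, j, hf, hj, hqc, hdom, hjf⟩ := exists_compactifiedPencil A p t q
  haveI := hf
  haveI := hj
  haveI := hqc
  haveI := hdom
  have hΩinj : Function.Injective (algebraMap A (AlgebraicClosure (FractionRing A))) := by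
    rw [IsScalarTower.algebraMap_eq A (FractionRing A) (AlgebraicClosure (FractionRing A))]
    exact (algebraMap (FractionRing A) _).injective.comp (IsFractionRing.injective A (FractionRing A))
  have hint : IsIntegral (pullback f (Spec.map (CommRingCat.ofHom
      (algebraMap A (AlgebraicClosure (FractionRing A)))))) :=
    isIntegral_pullback_of_pencil_dense p t q hqp f j hjf _ (ringHom_flat_of_injective_of_field _ hΩinj)
  refine not_familyResolutionSep_of_witness A 𝒳 f hint ?_
  intro A' _ _ _ hinj hft _ hsep 𝒴 G hall
  -- the generic and the geometric generic point of `Spec A'`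
  haveI : CharP A' p := charP_of_injective_algebraMap hinj p
  haveI : CharP (FractionRing A') p :=
    charP_of_injective_algebraMap (IsFractionRing.injective A' (FractionRing A')) p
  have hflat : ((algebraMap A' (FractionRing A')).comp (algebraMap A A')).Flat :=
    ringHom_flat_of_injective_of_field _ ((IsFractionRing.injective A' (FractionRing A')).comp hinj)
  have ht' := irreducible_X_pow_sub_C_of_formallyUnramified p hinj hft hsep t ht
  exact false_of_isWeakResolution_two_fibres p t q hqp f j hjf (algebraMap A' (FractionRing A'))
    (algebraMap (FractionRing A') (AlgebraicClosure (FractionRing A'))) hflat ht' G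
    (hall _ _) (hall _ _)


/-- **THE RESOLVING BASE MUST EXTRACT A `p`-TH ROOT OF THE PARAMETER.** Let `f : 𝒳 → Spec A` (locally of finite
type, `A` a domain of characteristic `p`) contain the Kollár pencil `y^q = x^p − t` as a quasi-compact
scheme-theoretically dominant open over `A`, and let `A → A'` be an injective map of domains. If SOME
`G : 𝒴 → 𝒳 ×_A Spec A'` has both its fibre over the generic point `Spec (Frac A')` and its fibre over the geometric
generic point `Spec (Frac A')^{alg}` weak resolutions (as every `G` delivered by `CampaignW82.FamilyResolution` does),
then `t` is a `p`-th power in `Frac A'`. This is the invariant form of the separable tightness: whatever the base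
extension, it has to adjoin `t^{1/p}` generically (`X^p − t` is irreducible over a field iff `t` is not a `p`-th
power there, `X_pow_sub_C_irreducible_of_prime`; then `false_of_isWeakResolution_two_fibres`). [cite: Kollar2007, 1.19] -/
theorem exists_pow_eq_of_isWeakResolution_generic_fibres (p : ℕ) [Fact p.Prime] (q : ℕ) [Fact q.Prime]
    (hqp : q ≠ p) {A : Type} [CommRing A] [IsDomain A] [CharP A p] (t : A)
    {𝒳 : Scheme.{0}} (f : 𝒳 ⟶ Spec (.of A)) [LocallyOfFiniteType f]
    (j : pencil A p t q ⟶ 𝒳) [IsOpenImmersion j] [QuasiCompact j] [IsSchemeTheoreticallyDominant j]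
    (hj : j ≫ f = pencilTo A p t q)
    {A' : Type} [CommRing A'] [IsDomain A'] [Algebra A A'] (hinj : Function.Injective (algebraMap A A'))
    {𝒴 : Scheme.{0}} (G : 𝒴 ⟶ pullback f (Spec.map (CommRingCat.ofHom (algebraMap A A'))))
    (h₁ : IsWeakResolution
      (pullback.snd G
        (pullback.fst (pullback.snd f (Spec.map (CommRingCat.ofHom (algebraMap A A'))))
          (Spec.map (CommRingCat.ofHom (algebraMap A' (FractionRing A')))))))
    (h₂ : IsWeakResolution
      (pullback.snd G
        (pullback.fst (pullback.snd f (Spec.map (CommRingCat.ofHom (algebraMap A A'))))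
          (Spec.map (CommRingCat.ofHom ((algebraMap (FractionRing A') (AlgebraicClosure (FractionRing A'))).comp
            (algebraMap A' (FractionRing A')))))))) :
    ∃ s : FractionRing A', s ^ p = algebraMap A' (FractionRing A') (algebraMap A A' t) := by
  have hp : p.Prime := Fact.out
  by_contra hno
  have ht : Irreducible (X ^ p - C (algebraMap A' (FractionRing A') (algebraMap A A' t)) : (FractionRing A')[X]) :=
    X_pow_sub_C_irreducible_of_prime hp fun b hb => hno ⟨b, hb⟩
  haveI : CharP A' p := charP_of_injective_algebraMap hinj p
  haveI : CharP (FractionRing A') p :=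
    charP_of_injective_algebraMap (IsFractionRing.injective A' (FractionRing A')) p
  have hflat : ((algebraMap A' (FractionRing A')).comp (algebraMap A A')).Flat :=
    ringHom_flat_of_injective_of_field _ ((IsFractionRing.injective A' (FractionRing A')).comp hinj)
  exact false_of_isWeakResolution_two_fibres p t q hqp f j hj (algebraMap A' (FractionRing A'))
    (algebraMap (FractionRing A') (AlgebraicClosure (FractionRing A'))) hflat ht G h₁ h₂

/-- `t` is not a `p`-th power in `k(t) = Frac k[t]` (`p ≥ 2`): comparing degrees in `f^p = t·g^p`.
[folklore] -/
theorem irreducible_X_pow_sub_C_polynomialX (k : Type) [Field k] (p : ℕ) [Fact p.Prime] :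
    Irreducible (X ^ p - C (algebraMap k[X] (FractionRing k[X]) Polynomial.X) : (FractionRing k[X])[X]) := by
  have hp : p.Prime := Fact.out
  refine X_pow_sub_C_irreducible_of_prime hp fun b hb => ?_
  obtain ⟨f, g, hg, rfl⟩ := IsFractionRing.div_surjective (A := k[X]) b
  have hg0 : algebraMap k[X] (FractionRing k[X]) g ≠ 0 :=
    IsFractionRing.to_map_ne_zero_of_mem_nonZeroDivisors hg
  have hg0' : g ≠ 0 := nonZeroDivisors.ne_zero hg
  have hfg : f ^ p = Polynomial.X * g ^ p := by
    apply IsFractionRing.injective k[X] (FractionRing k[X])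
    rw [map_pow, map_mul, map_pow, ← hb, div_pow, div_mul_cancel₀ _ (pow_ne_zero _ hg0)]
  have hf0 : f ≠ 0 := by
    rintro rfl
    rw [zero_pow hp.ne_zero, zero_eq_mul] at hfg
    exact hfg.elim Polynomial.X_ne_zero (pow_ne_zero _ hg0')
  have hdeg := congrArg Polynomial.natDegree hfg
  rw [Polynomial.natDegree_pow, Polynomial.natDegree_mul Polynomial.X_ne_zero (pow_ne_zero _ hg0'),
    Polynomial.natDegree_X, Polynomial.natDegree_pow] at hdeg
  have h1 : p ∣ 1 := by
    have : p ∣ 1 + p * g.natDegree := ⟨f.natDegree, hdeg.symm⟩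
    exact (Nat.dvd_add_left (dvd_mul_right p _)).mp this
  exact hp.one_lt.ne' (Nat.dvd_one.mp h1)

/-- **SEPARABLE TIGHTNESS OF RESOLUTION IN FAMILIES.** For EVERY field `k` of characteristic `p > 0`:
`¬ CampaignW82.FamilyResolutionSep k` — resolution in families (`CampaignW82.FamilyResolution`, the family
form of the crux `PrimeModelTransfer`, p526769/p532272) becomes FALSE as soon as the base extension
`A → A'` is required to be separable (generically étale). Witness: `A = k[t]`, the compactified Kollár pencil
`y^q = x^p − t`. Together with the door-1 theorem that the RADICIAL variant `CampaignW82.FamilyResolutionInsep`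
is equivalent to resolution over perfect fields (p535806), this pins the inseparability in the family form:
the base extension must be inseparable and may be taken purely inseparable. [cite: Kollar2007, 1.19] -/
theorem not_familyResolutionSep (k : Type) [Field k] (p : ℕ) [Fact p.Prime] [CharP k p] :
    ¬ FamilyResolutionSep k :=
  not_familyResolutionSep_of_pencilWitness p k[X] Polynomial.X (irreducible_X_pow_sub_C_polynomialX k p)

/-- The same for the algebraic closure of the prime field (door 2's ground field `𝔽̄_p`), where
`CampaignW82.FamilyResolution (AlgebraicClosure (ZMod p))` is EQUIVALENT to the crux slice
(`CampaignW82.algClosedRes_iff_familyResolution`, p532272): the separable variant of that equivalent is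
refuted outright. [folklore] -/
theorem not_familyResolutionSep_algebraicClosure_zmod (p : ℕ) [Fact p.Prime] :
    ¬ FamilyResolutionSep (AlgebraicClosure (ZMod p)) :=
  not_familyResolutionSep (AlgebraicClosure (ZMod p)) p

end Headline

end Summit.ResolutionOfSingularities.ResolutionOfSingularities.Theorems.CampaignW82.SeparableTightness

end
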